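import Literature.Probability.Percolation.IsoradialRectangularCrossings
import Literature.Probability.Percolation.QuadCrossingLowerSets
import HarnessLib

/-!
# DKKMO, Theorem 2.1 at `q = 1`, Schramm–Smirnov half (named fact)

Topic `Probability/Percolation`; companion of `IsoradialRectangularCrossings.lean` (the per-quad
reading `DKKMO2020_thm21_quadCrossingProb` of Duminil-Copin–Kozlowski–Krachun–Manolescu–Oulamara,
arXiv:2012.11672v1, Theorem 2.1 at `q = 1`) and of `QuadCrossingRotationCoupling.lean` (the same
rendering for Theorem 1.2, `dkkmo_theorem_1_2_schrammSmirnov`). The printed Theorem 2.1 (p. 7) is a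
COUPLING statement: "For `q ∈ [1,4]` and `ε > 0`, there exists `δ₀ = δ₀(q, ε) > 0` such that for
every `δ < δ₀` and `α ∈ (ε, π - ε)`, there exists a coupling `P_{α,δ,ε}` between `ω ∼ φ_{δ𝕃(α)}`
and `ω' ∼ φ_{δ𝕃(π/2)}` such that `P_{α,δ,ε}[d_CN(ω, ω') > ε] < ε` and
`P_{α,δ,ε}[d_SS(ω, ω') > ε] < ε`." Its `d_CN` half is (v2, Thm. 1.7) the named fact
`dkkmo_theorem_1_7` of `LoopRepresentation.lean`; this file vendors the `d_SS` half, from which the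
paper reads crossing probabilities of a fixed quad ("the measurability of `𝒞(Q)` in the
Schramm–Smirnov topology", §7.1 p. 43) — that reading is PROVED in
`IsoradialRectangularCrossingsOfSS.lean`.

* `isoRectQuadConfig α δ ω` — the configuration `ω` of the abstract `ℤ²`, drawn on `δ𝕃(α)`
  (`isoRectDrawing α` rescaled by `δ`), seen as an element of Schramm–Smirnov's space
  `ℋ_ℂ = QuadConfig univ`: the closure of the set of quads crossed inside the drawn open edges
  (`QuadCrossing.configOf`; pairs off the edge set of `ℤ²`, a null event, are ignored, exactly as in
  `z2QuadConfig`).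
* `DKKMO2020_thm21_schrammSmirnov` — the ONE NAMED FACT of this file: Theorem 2.1, `d_SS` part,
  `q = 1` (`φ_{δ𝕃(α)}` = `prodBernoulli (isoRectCriticalProb α)`, infinite volume, as in the sibling
  fact). "`d_SS`, the metric (whose definition is implicit)" (§1.2 p. 4) is rendered METRIC-FREE, as
  for Theorem 1.2: for every open neighbourhood `N` of the diagonal of `ℋ_ℂ × ℋ_ℂ` the coupled pair
  `(S^{α}_{ω}, S^{π/2}_{ω'})` lies in `N` outside an event of probability `< ε`, for
  `α ∈ (ε, π - ε)`, `0 < δ ≤ δ₀(ε, N)`.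
* `DKKMO2020_thm21_schrammSmirnov_of_dist`, `dist_lt_of_DKKMO2020_thm21_schrammSmirnov` (PROVED) —
  equivalence with the printed form `ℙ[d_SS > ε] < ε` for any jointly continuous `d` on `ℋ_ℂ`,
  positive off the diagonal and vanishing on it (any metric inducing the topology; `ℋ_ℂ` is compact,
  `QuadConfig.compactSpace`, and metrizable, Schramm–Smirnov Thm. 1.4).

## References

* [DKKMO2020Rotational] H. Duminil-Copin, K. K. Kozlowski, D. Krachun, I. Manolescu, M. Oulamara,
  *Rotational invariance in critical planar lattice models*, arXiv:2012.11672v1 (2020): §1.2 p. 4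
  (`ℋ`, `d_SS`), §2.1–2.2 p. 7 (`𝕃(α)`, `φ_{δ𝕃(α)}`), Theorem 2.1 p. 7, §7.1 p. 43.
* [SchrammSmirnov2011] O. Schramm, S. Smirnov, Ann. Probab. 39 (2011), §1.3, Thm. 1.4.
-/

noncomputable section

open Set Filter
open _root_.MeasureTheory _root_.Topology
open scoped ENNReal
open Literature.Probability.LatticeModels

namespace Literature.Probability.Percolation

open QuadCrossing

/-- **`ω` drawn on `δ𝕃(α)`, as an element of Schramm–Smirnov's space `ℋ_ℂ`** (DKKMO §1.2 p. 4:
"A configuration `ω` can be identified with the (automatically hereditary) set `S ∈ ℋ` containing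
all the quads that are crossed by an open path in `ω` (seen as a continuous path in the plane)"):
the closure in `𝒬_ℂ` of the set of quads having a crossing inside the open edges of `ω` drawn at
mesh `δ` along `isoRectDrawing α` (`QuadCrossing.configOf`). Pairs of `ω` off the edge set of `ℤ²`
(a null event for `prodBernoulli (isoRectCriticalProb α)`) are ignored, as in `z2QuadConfig`.
[cite: DKKMO2020Rotational, §1.2 p. 4 and §2.1 p. 7] -/
def isoRectQuadConfig (α δ : ℝ) (ω : BondConfig (Site 2)) : QuadConfig (univ : Set ℂ) :=
  configOf (isoRectDrawing α) δ univ (ω ∩ (zdGraph 2).edgeSet)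

/-- `coe_isoRectQuadConfig`: as a set of quads, `S^{α}_{ω}` is the closure of the quads having a
crossing inside the open edges of `ω ∩ E(ℤ²)` drawn along `isoRectDrawing α` at mesh `δ`
(`openEdgeRealization`). [cite: DKKMO2020Rotational, §1.2 p. 4] -/
theorem coe_isoRectQuadConfig (α δ : ℝ) (ω : BondConfig (Site 2)) :
    (isoRectQuadConfig α δ ω : Set (Quad (univ : Set ℂ))) =
      closure {Q | ∃ K, Q.IsCrossing K ∧
        K ⊆ openEdgeRealization (isoRectDrawing α) δ (ω ∩ (zdGraph 2).edgeSet)} :=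
  rfl

/-- **DKKMO, Theorem 2.1 (`d_SS` part) at `q = 1`** (Duminil-Copin–Kozlowski–Krachun–Manolescu–
Oulamara, arXiv:2012.11672v1, Thm. 2.1 p. 7: "For `q ∈ [1,4]` and `ε > 0`, there exists
`δ₀ = δ₀(q, ε) > 0` such that for every `δ < δ₀` and `α ∈ (ε, π - ε)`, there exists a coupling
`P_{α,δ,ε}` between `ω ∼ φ_{δ𝕃(α)}` and `ω' ∼ φ_{δ𝕃(π/2)}` such that …
`P_{α,δ,ε}[d_SS(ω, ω') > ε] < ε`. This result states the universality of the scaling limit among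
rectangular lattices."). Here `q = 1`: `φ_{δ𝕃(α)}` is Bernoulli bond percolation on the abstract
`ℤ²` with the canonical isoradial weights, `prodBernoulli (isoRectCriticalProb α)` (§2.2 p. 7), the
lattice drawn as `δ𝕃(α)` (`isoRectDrawing α`, §2.1 p. 7), and a configuration is read in the
Schramm–Smirnov space `ℋ_ℂ = QuadConfig univ` as `isoRectQuadConfig α δ ω`. The event `d_SS > ε`
("`d_SS`, the metric whose definition is implicit", §1.2 p. 4) is rendered METRIC-FREE: for every
open neighbourhood `N` of the diagonal of `ℋ_ℂ × ℋ_ℂ`,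
`ℙ[(S^{α}_{ω}, S^{π/2}_{ω'}) ∉ N] < ε` for `α ∈ (ε, π - ε)` and `0 < δ ≤ δ₀(ε, N)` — equivalent to
the printed form for any metric inducing the topology (`DKKMO2020_thm21_schrammSmirnov_of_dist`,
`dist_lt_of_DKKMO2020_thm21_schrammSmirnov`; `ℋ_ℂ` is compact metrizable, Schramm–Smirnov
Thm. 1.4), and of the same shape as `dkkmo_theorem_1_2_schrammSmirnov`. The `d_CN` half is
`dkkmo_theorem_1_7` (`LoopRepresentation.lean`); the per-quad reading
`DKKMO2020_thm21_quadCrossingProb` follows from this fact and Schramm–Smirnov's Lemma 5.1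
(`IsoradialRectangularCrossingsOfSS.lean`). Named fact (D-0014), not proved here.
-- TODO(general form): `q ∈ [1,4]` random-cluster measures `φ_{δ𝕃(α)}`.
[cite: DKKMO2020Rotational, Thm 2.1 (q = 1, d_SS part)] -/
def DKKMO2020_thm21_schrammSmirnov : Prop :=
  ∀ ε : ℝ, 0 < ε →
    ∀ N : Set (QuadConfig (univ : Set ℂ) × QuadConfig (univ : Set ℂ)), IsOpen N →
      (∀ S, (S, S) ∈ N) →
      ∃ δ₀ : ℝ, 0 < δ₀ ∧ ∀ α ∈ Set.Ioo ε (Real.pi - ε), ∀ δ : ℝ, 0 < δ → δ ≤ δ₀ →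
        ∃ P : Measure (BondConfig (Site 2) × BondConfig (Site 2)),
          P.map Prod.fst = prodBernoulli (isoRectCriticalProb α) ∧
          P.map Prod.snd = prodBernoulli (isoRectCriticalProb (Real.pi / 2)) ∧
          P {p | (isoRectQuadConfig α δ p.1, isoRectQuadConfig (Real.pi / 2) δ p.2) ∉ N} <
            ENNReal.ofReal ε

/-- **The printed (metric) form implies the metric-free one.** For any jointly continuous
distance-like function `d` on `ℋ_ℂ`, positive off the diagonal — in particular any metric `d_SS`
inducing the topology — the printed statement "for every `ε > 0` there is `δ₀ > 0` such that for
`α ∈ (ε, π - ε)`, `0 < δ ≤ δ₀` some coupling of `φ_{δ𝕃(α)}` and `φ_{δ𝕃(π/2)}` has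
`ℙ[d_SS(ω, ω') > ε] < ε`" implies `DKKMO2020_thm21_schrammSmirnov`: `ℋ_ℂ × ℋ_ℂ` is compact
(`QuadConfig.compactSpace`), so `d` has a positive minimum on the complement of an open
neighbourhood `N` of the diagonal, and the printed statement at a smaller `ε` only widens the
angle range. [cite: DKKMO2020Rotational, Thm 2.1 (d_SS part)] -/
theorem DKKMO2020_thm21_schrammSmirnov_of_dist
    (d : QuadConfig (univ : Set ℂ) → QuadConfig (univ : Set ℂ) → ℝ)
    (hdc : Continuous fun p : QuadConfig (univ : Set ℂ) × QuadConfig (univ : Set ℂ) => d p.1 p.2)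
    (hdpos : ∀ S S', S ≠ S' → 0 < d S S')
    (hSSd : ∀ ε : ℝ, 0 < ε → ∃ δ₀ : ℝ, 0 < δ₀ ∧ ∀ α ∈ Set.Ioo ε (Real.pi - ε), ∀ δ : ℝ, 0 < δ →
      δ ≤ δ₀ → ∃ P : Measure (BondConfig (Site 2) × BondConfig (Site 2)),
        P.map Prod.fst = prodBernoulli (isoRectCriticalProb α) ∧
        P.map Prod.snd = prodBernoulli (isoRectCriticalProb (Real.pi / 2)) ∧
        P {p | ε < d (isoRectQuadConfig α δ p.1) (isoRectQuadConfig (Real.pi / 2) δ p.2)} <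
          ENNReal.ofReal ε) :
    DKKMO2020_thm21_schrammSmirnov := by
  intro ε hε N hN hdiag
  haveI : CompactSpace (QuadConfig (univ : Set ℂ)) := QuadConfig.compactSpace
  -- a positive `ε₁` with `{d < ε₁} ⊆ N`
  obtain ⟨ε₁, hε₁, hsub⟩ : ∃ ε₁ : ℝ, 0 < ε₁ ∧
      ∀ p : QuadConfig (univ : Set ℂ) × QuadConfig (univ : Set ℂ), d p.1 p.2 < ε₁ → p ∈ N := by
    by_cases hF : (Nᶜ : Set _).Nonempty
    · obtain ⟨p₀, hp₀, hmin⟩ := hN.isClosed_compl.isCompact.exists_isMinOn hF hdc.continuousOn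
      have hp₀pos : 0 < d p₀.1 p₀.2 := by
        refine hdpos _ _ fun heq => hp₀ ?_
        have : p₀ = (p₀.1, p₀.1) := Prod.ext rfl heq.symm
        rw [this]; exact hdiag _
      refine ⟨d p₀.1 p₀.2, hp₀pos, fun p hp => ?_⟩
      by_contra hpN
      exact (not_le.2 hp) (hmin hpN)
    · exact ⟨1, one_pos, fun p _ => by by_contra hpN; exact hF ⟨p, hpN⟩⟩
  have hε' : 0 < min ε (ε₁ / 2) := lt_min hε (by linarith)
  obtain ⟨δ₀, hδ₀, H⟩ := hSSd (min ε (ε₁ / 2)) hε'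
  refine ⟨δ₀, hδ₀, fun α hα δ hδ hδ₀' => ?_⟩
  have hα' : α ∈ Set.Ioo (min ε (ε₁ / 2)) (Real.pi - min ε (ε₁ / 2)) :=
    ⟨(min_le_left _ _).trans_lt hα.1, hα.2.trans_le (by linarith [min_le_left ε (ε₁ / 2)])⟩
  obtain ⟨P, h1, h2, hP⟩ := H α hα' δ hδ hδ₀'
  refine ⟨P, h1, h2, ((measure_mono fun p hp => ?_).trans_lt hP).trans_le
    (ENNReal.ofReal_le_ofReal (min_le_left _ _))⟩
  show min ε (ε₁ / 2) < d _ _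
  by_contra hle
  exact hp (hsub _ ((not_lt.1 hle).trans_lt (by linarith [min_le_right ε (ε₁ / 2)])))

/-- **The metric-free form gives back the printed bound** for every jointly continuous `d` on
`ℋ_ℂ` vanishing on the diagonal (in particular every metric inducing the topology): `{d < ε}` is an
open neighbourhood of the diagonal, so `ℙ[d(S^{α}_{ω}, S^{π/2}_{ω'}) > ε] ≤ ℙ[∉ {d < ε}] < ε` for
`α ∈ (ε, π - ε)`, `0 < δ ≤ δ₀(ε)`. [cite: DKKMO2020Rotational, Thm 2.1 (d_SS part)] -/
theorem dist_lt_of_DKKMO2020_thm21_schrammSmirnov (h : DKKMO2020_thm21_schrammSmirnov)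
    (d : QuadConfig (univ : Set ℂ) → QuadConfig (univ : Set ℂ) → ℝ)
    (hdc : Continuous fun p : QuadConfig (univ : Set ℂ) × QuadConfig (univ : Set ℂ) => d p.1 p.2)
    (hd0 : ∀ S, d S S = 0) {ε : ℝ} (hε : 0 < ε) :
    ∃ δ₀ : ℝ, 0 < δ₀ ∧ ∀ α ∈ Set.Ioo ε (Real.pi - ε), ∀ δ : ℝ, 0 < δ → δ ≤ δ₀ →
      ∃ P : Measure (BondConfig (Site 2) × BondConfig (Site 2)),
        P.map Prod.fst = prodBernoulli (isoRectCriticalProb α) ∧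
        P.map Prod.snd = prodBernoulli (isoRectCriticalProb (Real.pi / 2)) ∧
        P {p | ε < d (isoRectQuadConfig α δ p.1) (isoRectQuadConfig (Real.pi / 2) δ p.2)} <
          ENNReal.ofReal ε := by
  set N : Set (QuadConfig (univ : Set ℂ) × QuadConfig (univ : Set ℂ)) := {p | d p.1 p.2 < ε}
    with hN
  have hNopen : IsOpen N := isOpen_lt hdc continuous_const
  have hdiag : ∀ S, (S, S) ∈ N := fun S => by show d S S < ε; rw [hd0]; exact hε
  obtain ⟨δ₀, hδ₀, H⟩ := h ε hε N hNopen hdiag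
  refine ⟨δ₀, hδ₀, fun α hα δ hδ hδ₀' => ?_⟩
  obtain ⟨P, h1, h2, hP⟩ := H α hα δ hδ hδ₀'
  refine ⟨P, h1, h2, (measure_mono fun p hp => ?_).trans_lt hP⟩
  show ¬ d _ _ < ε
  exact not_lt.2 (le_of_lt hp)

end Literature.Probability.Percolation

end
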